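import Mathlib
import Summits.Ventures.PercRepro2.K5HyperCoeffsI
import Summits.Ventures.PercRepro2.K5HyperTheorem
import Summits.Ventures.PercRepro2.K5TypedI

/-!
# THE (i)-SIDE STAR COMPARISONS AS PROFILE SUMS OF p1's STATE KERNEL `KI` ON `K₅`
(blind cell PercRepro2, typer-1 g10; mine-1 §23.5 — the dictionary between `K5HyperCoeffsI.lean` and the
(i) kernel)

`NOnI S₁ S₂ S₃ k = Σ_{prof x y w = k} KI(x ∨ S₁, y ∨ S₂, w ∨ S₃)` is the hyperedge-augmented typed count
(`typedCountHyper`, every edge typed, the profile `k`) of the cleared (i) kernel `CaseOne.KI`; `NOnI_eq`: it is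
`cNegOnI − cPosOnI` (`K5TypedI.KI_apply`).  `NT1I`, `NT2I`, `NT1e1I`, `NE3I` are the placement sums
(`csumT1`, … with `NOnI`).  From the kernel certificates:

* **`MI_real`**: `N⁽ⁱ⁾(H + D(1)) ≤ N⁽ⁱ⁾(H + D(1) + P(1))` — `M-(i) ≥ 0`;
* **`TvTI_real`**: `N⁽ⁱ⁾(H + T(1)) ≤ N⁽ⁱ⁾(H + △(1,1,1))` — `TvT-(i) ≥ 0`;
* **`T1I_real`**, **`T2I_real`**: `0 ≤ N⁽ⁱ⁾(H + D(1))`, `0 ≤ N⁽ⁱ⁾(H + D(2))`.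
-/

namespace Summit.Ventures.PercRepro2

open Hub

namespace K5

section DictionaryI

variable {R : Type*} [Field R] [LinearOrder R] [IsStrictOrderedRing R]

/-- The masked profile sum of the (i) kernel. -/
noncomputable def NOnI (S₁ S₂ S₃ : Fin 10 → Bool) (k : Fin 10 → Fin 4) : R :=
  typedCountHyper Finset.univ (fun _ => false) (fun e => (k e : ℕ)) S₁ S₂ S₃
    (CaseOne.KI (R := R) ends5 0 1 2 3 4)

/-- The placement sum of a real-valued pattern function: `D` in exactly one copy. -/
noncomputable def rsumT1 (N : (Fin 10 → Bool) → (Fin 10 → Bool) → (Fin 10 → Bool) → R) (D : Fin 10 → Bool) :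
    R := N D mNone mNone + N mNone D mNone + N mNone mNone D

/-- `D` in exactly two copies. -/
noncomputable def rsumT2 (N : (Fin 10 → Bool) → (Fin 10 → Bool) → (Fin 10 → Bool) → R) (D : Fin 10 → Bool) :
    R := N D D mNone + N D mNone D + N mNone D D

/-- `D` in one copy and `P` in one copy. -/
noncomputable def rsumT1e1 (N : (Fin 10 → Bool) → (Fin 10 → Bool) → (Fin 10 → Bool) → R)
    (D P : Fin 10 → Bool) : R :=
  N (mOr D P) mNone mNone + N D P mNone + N D mNone P + N P D mNone + N mNone (mOr D P) mNone +
    N mNone D P + N P mNone D + N mNone P D + N mNone mNone (mOr D P)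

/-- Three edge sets each in one copy (`27` placements). -/
noncomputable def rsumE3 (N : (Fin 10 → Bool) → (Fin 10 → Bool) → (Fin 10 → Bool) → R)
    (P₁ P₂ P₃ : Fin 10 → Bool) : R :=
  (N (mOr (mOr P₁ P₂) P₃) mNone mNone + N (mOr P₁ P₂) P₃ mNone + N (mOr P₁ P₂) mNone P₃ +
    N (mOr P₁ P₃) P₂ mNone + N P₁ (mOr P₂ P₃) mNone + N P₁ P₂ P₃ + N (mOr P₁ P₃) mNone P₂ + N P₁ P₃ P₂ +
    N P₁ mNone (mOr P₂ P₃)) +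
  (N (mOr P₂ P₃) P₁ mNone + N P₂ (mOr P₁ P₃) mNone + N P₂ P₁ P₃ + N P₃ (mOr P₁ P₂) mNone +
    N mNone (mOr (mOr P₁ P₂) P₃) mNone + N mNone (mOr P₁ P₂) P₃ + N P₃ P₁ P₂ + N mNone (mOr P₁ P₃) P₂ +
    N mNone P₁ (mOr P₂ P₃)) +
  (N (mOr P₂ P₃) mNone P₁ + N P₂ P₃ P₁ + N P₂ mNone (mOr P₁ P₃) + N P₃ P₂ P₁ + N mNone (mOr P₂ P₃) P₁ +
    N mNone P₂ (mOr P₁ P₃) + N P₃ mNone (mOr P₁ P₂) + N mNone P₃ (mOr P₁ P₂) +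
    N mNone mNone (mOr (mOr P₁ P₂) P₃))

/-- `N⁽ⁱ⁾(H + D(1))`. -/
noncomputable def NT1I (D : Fin 10 → Bool) (k : Fin 10 → Fin 4) : R := rsumT1 (fun S₁ S₂ S₃ => NOnI S₁ S₂ S₃ k) D

/-- `N⁽ⁱ⁾(H + D(2))`. -/
noncomputable def NT2I (D : Fin 10 → Bool) (k : Fin 10 → Fin 4) : R := rsumT2 (fun S₁ S₂ S₃ => NOnI S₁ S₂ S₃ k) D

/-- `N⁽ⁱ⁾(H + D(1) + P(1))`. -/
noncomputable def NT1e1I (D P : Fin 10 → Bool) (k : Fin 10 → Fin 4) : R :=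
  rsumT1e1 (fun S₁ S₂ S₃ => NOnI S₁ S₂ S₃ k) D P

/-- `N⁽ⁱ⁾(H + P₁(1) + P₂(1) + P₃(1))`. -/
noncomputable def NE3I (P₁ P₂ P₃ : Fin 10 → Bool) (k : Fin 10 → Fin 4) : R :=
  rsumE3 (fun S₁ S₂ S₃ => NOnI S₁ S₂ S₃ k) P₁ P₂ P₃

omit [LinearOrder R] [IsStrictOrderedRing R] in
/-- **The dictionary**: the masked profile sum of `KI` is `cNegOnI − cPosOnI`. -/
theorem NOnI_eq (S₁ S₂ S₃ : Fin 10 → Bool) (k : Fin 10 → Fin 4) :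
    NOnI (R := R) S₁ S₂ S₃ k = ((cNegOnI S₁ S₂ S₃ k : ℕ) : R) - ((cPosOnI S₁ S₂ S₃ k : ℕ) : R) := by
  unfold NOnI typedCountHyper
  have hK : (fun x y w => CaseOne.KI (R := R) ends5 0 1 2 3 4 (orOn S₁ x) (orOn S₂ y) (orOn S₃ w)) =
      fun x y w =>
        (indR (fun ω => tQBL (orOn S₁ ω)) x * indR (fun ω => tAO (orOn S₂ ω)) y *
            indR (fun ω => tPD (orOn S₃ ω)) w +
          indR (fun ω => tABL (orOn S₁ ω)) x * indR (fun ω => tPDoU (orOn S₂ ω)) y *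
            indR (fun ω => tQ (orOn S₃ ω)) w) -
        (indR (fun ω => tABOL (orOn S₁ ω)) x * indR (fun ω => tQ (orOn S₂ ω)) y *
            indR (fun ω => tPD (orOn S₃ ω)) w +
          indR (fun ω => tQBL (orOn S₁ ω)) x * indR (fun ω => tPDoU (orOn S₂ ω)) y *
            indR (fun ω => tA (orOn S₃ ω)) w) := by
    funext x y w
    rw [KI_apply]
    simp only [indR]
    ring
  rw [hK, typedCount_sub, typedCount_add, typedCount_add]
  simp only [typedCount_tables Finset.univ (fun _ => false) (fun e => (k e : ℕ)) k (profile_univ k)]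
  unfold cPosOnI cNegOnI cOn
  push_cast
  ring

omit [LinearOrder R] [IsStrictOrderedRing R] in
/-- `N⁽ⁱ⁾(H + D(1)) = csumT1 cNegOnI − csumT1 cPosOnI`. -/
lemma NT1I_eq (D : Fin 10 → Bool) (k : Fin 10 → Fin 4) :
    NT1I (R := R) D k = ((csumT1 cNegOnI D k : ℕ) : R) - ((csumT1 cPosOnI D k : ℕ) : R) := by
  unfold NT1I rsumT1 csumT1
  simp only [NOnI_eq]
  push_cast
  ring

omit [LinearOrder R] [IsStrictOrderedRing R] in
/-- `N⁽ⁱ⁾(H + D(2)) = csumT2 cNegOnI − csumT2 cPosOnI`. -/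
lemma NT2I_eq (D : Fin 10 → Bool) (k : Fin 10 → Fin 4) :
    NT2I (R := R) D k = ((csumT2 cNegOnI D k : ℕ) : R) - ((csumT2 cPosOnI D k : ℕ) : R) := by
  unfold NT2I rsumT2 csumT2
  simp only [NOnI_eq]
  push_cast
  ring

omit [LinearOrder R] [IsStrictOrderedRing R] in
/-- `N⁽ⁱ⁾(H + D(1) + P(1)) = csumT1e1 cNegOnI − csumT1e1 cPosOnI`. -/
lemma NT1e1I_eq (D P : Fin 10 → Bool) (k : Fin 10 → Fin 4) :
    NT1e1I (R := R) D P k = ((csumT1e1 cNegOnI D P k : ℕ) : R) - ((csumT1e1 cPosOnI D P k : ℕ) : R) := by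
  unfold NT1e1I rsumT1e1 csumT1e1
  simp only [NOnI_eq]
  push_cast
  ring

omit [LinearOrder R] [IsStrictOrderedRing R] in
/-- `N⁽ⁱ⁾(H + P₁(1) + P₂(1) + P₃(1)) = csumE3 cNegOnI − csumE3 cPosOnI`. -/
lemma NE3I_eq (P₁ P₂ P₃ : Fin 10 → Bool) (k : Fin 10 → Fin 4) :
    NE3I (R := R) P₁ P₂ P₃ k = ((csumE3 cNegOnI P₁ P₂ P₃ k : ℕ) : R) - ((csumE3 cPosOnI P₁ P₂ P₃ k : ℕ) : R) := by
  unfold NE3I rsumE3 csumE3 csumE3a csumE3b csumE3c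
  simp only [NOnI_eq]
  push_cast
  ring

/-- **`M-(i) ≥ 0`: `N⁽ⁱ⁾(H + D(1)) ≤ N⁽ⁱ⁾(H + D(1) + P(1))`** from the certificate. -/
theorem MI_real (D P : Fin 10 → Bool) (hc : CertLE (kNegMI D P) (kPosMI D P)) (k : Fin 10 → Fin 4) :
    NT1I (R := R) D k ≤ NT1e1I (R := R) D P k := by
  have h := cNegMI_le_cPosMI D P hc k
  unfold cNegMI cPosMI at h
  rw [NT1I_eq, NT1e1I_eq, sub_le_sub_iff]
  exact_mod_cast (by omega :
    csumT1 cNegOnI D k + csumT1e1 cPosOnI D P k ≤ csumT1e1 cNegOnI D P k + csumT1 cPosOnI D k)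

/-- **`TvT-(i) ≥ 0`: `N⁽ⁱ⁾(H + T(1)) ≤ N⁽ⁱ⁾(H + △(1,1,1))`** from the certificate. -/
theorem TvTI_real (a b c : ℕ) (hc : CertLE (kNegTvTI a b c) (kPosTvTI a b c)) (k : Fin 10 → Fin 4) :
    NT1I (R := R) (triMask a b c) k ≤ NE3I (R := R) (pairMask a b) (pairMask a c) (pairMask b c) k := by
  have h := cNegTvTI_le_cPosTvTI a b c hc k
  unfold cNegTvTI cPosTvTI at h
  rw [NT1I_eq, NE3I_eq, sub_le_sub_iff]
  exact_mod_cast (by omega :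
    csumT1 cNegOnI (triMask a b c) k + csumE3 cPosOnI (pairMask a b) (pairMask a c) (pairMask b c) k ≤
      csumE3 cNegOnI (pairMask a b) (pairMask a c) (pairMask b c) k + csumT1 cPosOnI (triMask a b c) k)

/-- **`0 ≤ N⁽ⁱ⁾(H + D(1))`** from the certificate. -/
theorem T1I_real (D : Fin 10 → Bool) (hc : CertLE (sumT1 posOnI D) (sumT1 negOnI D)) (k : Fin 10 → Fin 4) :
    0 ≤ NT1I (R := R) D k := by
  rw [NT1I_eq, sub_nonneg]
  exact_mod_cast cT1I_le D hc k

/-- **`0 ≤ N⁽ⁱ⁾(H + D(2))`** from the certificate. -/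
theorem T2I_real (D : Fin 10 → Bool) (hc : CertLE (sumT2 posOnI D) (sumT2 negOnI D)) (k : Fin 10 → Fin 4) :
    0 ≤ NT2I (R := R) D k := by
  rw [NT2I_eq, sub_nonneg]
  exact_mod_cast cT2I_le D hc k

end DictionaryI

end K5

end Summit.Ventures.PercRepro2
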